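import Summits.KontsevichZagierPeriods.KontsevichZagierPeriods.Theses.InequalityCost

/-!
# Crux `InequalityCost.TameCovLimit` (stmt-KontsevichZagierPeriods-8987) — TYPED SPLIT of line `reparam` (strategist workfile)

Two pieces and the PROVED implication `TameCovLimit_of_subs : CovFamilyChartFactorisation → BoundedLegsCovLimit → TameCovLimit`
(sorry-free). NOT filed as a route edit by this seat (the registered LINE `Lines/reparam.lean` is the output; a lead /
tenure planner who prefers route-level staffing of the two halves runs the `--split` recorded in `STRATEGY-CENSUS.md`).

* `CovFamilyChartFactorisation` — pure o-minimal geometry, no KZ calculus: a tame `ℚ`-semialgebraic family of rule-2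
  instances factors near `t = 0⁺` through ONE real-semialgebraic cube family with two `C²`-bounded legs (= statement of
  `stub_c2GraphCharts`; Pila–Wilkie 2006 Thm 2.3 / tree `familyParam` + `uniformReparam`).
* `BoundedLegsCovLimit` — the crux RESTRICTED to families presented with such a factorisation (the package is an extra
  hypothesis); proved along line `reparam` by `stub_pointwiseLimit`, `stub_boundedGoodLocus`, `stub_realConfigDescent`,
  `stub_aeCovAssembly`.
-/

set_option linter.dupNamespace false

noncomputable section

open MeasureTheory Set Filter
open scoped Topology

namespace Summit.KontsevichZagierPeriods.KontsevichZagierPeriods.Cruxes.TameCovLimit.Split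

open Summit.KontsevichZagierPeriods.KontsevichZagierPeriods.Theses.InequalityCost (TameCovLimit)

/-- **Piece 1 (`CovFamilyChartFactorisation`).** [cite: PilaWilkie2006, Thm. 2.3, Cor. 5.2] -/
def CovFamilyChartFactorisation : Prop :=

    ∀ ⦃n : ℕ⦄ (N : ℕ) (S S' : Set (Fin (n + 1) → ℝ)) (G G' : (Fin (n + 1) → ℝ) → ℝ)
      (Φ : (Fin (n + 1) → ℝ) → (Fin n → ℝ)),
      Literature.ModelTheory.ExponentialFields.IsSemialgebraic ℚ S →
      Literature.NumberTheory.Transcendental.IsSemialgebraicFunOn ℚ S G →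
      Literature.ModelTheory.ExponentialFields.IsSemialgebraic ℚ S' →
      Literature.NumberTheory.Transcendental.IsSemialgebraicFunOn ℚ S' G' →
      Literature.NumberTheory.Transcendental.IsSemialgebraicMapOn ℚ S Φ →
      (∀ z ∈ S, (∀ i, |z i| ≤ N) ∧ |G z| ≤ N) → (∀ z ∈ S', (∀ i, |z i| ≤ N) ∧ |G' z| ≤ N) →
      (∀ t ∈ Set.Ioo (0:ℝ) 1,
        Set.InjOn (fun x : Fin n → ℝ => Φ (Fin.snoc x t)) {x | Fin.snoc x t ∈ S} ∧
        (fun x : Fin n → ℝ => Φ (Fin.snoc x t)) '' {x | Fin.snoc x t ∈ S} = {y | Fin.snoc y t ∈ S'} ∧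
        ∀ x : Fin n → ℝ, Fin.snoc x t ∈ S → ∃ L : (Fin n → ℝ) →L[ℝ] (Fin n → ℝ),
          HasFDerivWithinAt (fun x : Fin n → ℝ => Φ (Fin.snoc x t)) L {x | Fin.snoc x t ∈ S} x ∧
          G (Fin.snoc x t) = G' (Fin.snoc (Φ (Fin.snoc x t)) t) * |L.det|) →
      ∃ (K : ℕ) (C δ : ℝ) (D : Set (Fin (n + 1) → ℝ)) (ψ ψ' : (Fin (n + 1) → ℝ) → (Fin n → ℝ))
        (Dψ Dψ' : (Fin (n + 1) → ℝ) → (Fin n → ℝ) →L[ℝ] (Fin n → ℝ)),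
        (0 < δ ∧ δ ≤ 1) ∧
        Literature.ModelTheory.ExponentialFields.IsSemialgebraic ℝ D ∧
        (∀ z ∈ D, (∃ k : ℕ, k < K ∧ ∀ i, 2 * (k : ℝ) < Fin.init z i ∧ Fin.init z i < 2 * (k : ℝ) + 1) ∧
          z (Fin.last n) ∈ Set.Ioo (0:ℝ) δ) ∧
        (Literature.NumberTheory.Transcendental.IsSemialgebraicMapOn ℝ
            {z : Fin (n + 1) → ℝ | (∃ k : ℕ, k < K ∧ ∀ i, 2 * (k : ℝ) < Fin.init z i ∧
              Fin.init z i < 2 * (k : ℝ) + 1) ∧ z (Fin.last n) ∈ Set.Ioo (0:ℝ) δ} ψ ∧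
          Literature.NumberTheory.Transcendental.IsSemialgebraicMapOn ℝ
            {z : Fin (n + 1) → ℝ | (∃ k : ℕ, k < K ∧ ∀ i, 2 * (k : ℝ) < Fin.init z i ∧
              Fin.init z i < 2 * (k : ℝ) + 1) ∧ z (Fin.last n) ∈ Set.Ioo (0:ℝ) δ} ψ') ∧
        (∀ i j : Fin n,
          Literature.NumberTheory.Transcendental.IsSemialgebraicFunOn ℝ
            {z : Fin (n + 1) → ℝ | (∃ k : ℕ, k < K ∧ ∀ i, 2 * (k : ℝ) < Fin.init z i ∧
              Fin.init z i < 2 * (k : ℝ) + 1) ∧ z (Fin.last n) ∈ Set.Ioo (0:ℝ) δ}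
            (fun z => (Dψ z) (Pi.single j (1:ℝ)) i) ∧
          Literature.NumberTheory.Transcendental.IsSemialgebraicFunOn ℝ
            {z : Fin (n + 1) → ℝ | (∃ k : ℕ, k < K ∧ ∀ i, 2 * (k : ℝ) < Fin.init z i ∧
              Fin.init z i < 2 * (k : ℝ) + 1) ∧ z (Fin.last n) ∈ Set.Ioo (0:ℝ) δ}
            (fun z => (Dψ' z) (Pi.single j (1:ℝ)) i)) ∧
        (∀ t ∈ Set.Ioo (0:ℝ) δ, ∀ u : Fin n → ℝ,
          (∃ k : ℕ, k < K ∧ ∀ i, 2 * (k : ℝ) < u i ∧ u i < 2 * (k : ℝ) + 1) →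
          HasFDerivAt (fun v : Fin n → ℝ => ψ (Fin.snoc v t)) (Dψ (Fin.snoc u t)) u ∧
          HasFDerivAt (fun v : Fin n → ℝ => ψ' (Fin.snoc v t)) (Dψ' (Fin.snoc u t)) u ∧
          ‖Dψ (Fin.snoc u t)‖ ≤ C ∧ ‖Dψ' (Fin.snoc u t)‖ ≤ C ∧
          |(Dψ (Fin.snoc u t)).det| ≤ C ∧ |(Dψ' (Fin.snoc u t)).det| ≤ C ∧
          Fin.snoc (ψ (Fin.snoc u t)) t ∈ S ∧ Fin.snoc (ψ' (Fin.snoc u t)) t ∈ S' ∧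
          ψ' (Fin.snoc u t) = Φ (Fin.snoc (ψ (Fin.snoc u t)) t)) ∧
        (∀ t ∈ Set.Ioo (0:ℝ) δ, ∀ k : ℕ, k < K → ∀ u v : Fin n → ℝ,
          (∀ i, 2 * (k : ℝ) < u i ∧ u i < 2 * (k : ℝ) + 1) → (∀ i, 2 * (k : ℝ) < v i ∧ v i < 2 * (k : ℝ) + 1) →
          ‖Dψ (Fin.snoc u t) - Dψ (Fin.snoc v t)‖ ≤ C * ‖u - v‖ ∧
          ‖Dψ' (Fin.snoc u t) - Dψ' (Fin.snoc v t)‖ ≤ C * ‖u - v‖) ∧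
        (∀ t ∈ Set.Ioo (0:ℝ) δ,
          Set.InjOn (fun u : Fin n → ℝ => ψ (Fin.snoc u t)) {u | Fin.snoc u t ∈ D} ∧
          Set.InjOn (fun u : Fin n → ℝ => ψ' (Fin.snoc u t)) {u | Fin.snoc u t ∈ D} ∧
          MeasureTheory.volume ({x : Fin n → ℝ | Fin.snoc x t ∈ S} \
            (fun u : Fin n → ℝ => ψ (Fin.snoc u t)) '' {u | Fin.snoc u t ∈ D}) = 0 ∧
          MeasureTheory.volume ({y : Fin n → ℝ | Fin.snoc y t ∈ S'} \
            (fun u : Fin n → ℝ => ψ' (Fin.snoc u t)) '' {u | Fin.snoc u t ∈ D}) = 0) ∧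
        (∀ t ∈ Set.Ioo (0:ℝ) δ, ∀ u : Fin n → ℝ, Fin.snoc u t ∈ D →
          G (Fin.snoc (ψ (Fin.snoc u t)) t) * |(Dψ (Fin.snoc u t)).det| =
            G' (Fin.snoc (ψ' (Fin.snoc u t)) t) * |(Dψ' (Fin.snoc u t)).det|)

/-- **Piece 2 (`BoundedLegsCovLimit`)** — `TameCovLimit` for families given together with a `C²`-bounded two-leg cube
factorisation near `0⁺`. [cite: KontsevichZagier2001, §1.2 rule (2)] -/
def BoundedLegsCovLimit : Prop :=
    ∀ ⦃n : ℕ⦄ (N : ℕ) (S S' : Set (Fin (n + 1) → ℝ)) (G G' : (Fin (n + 1) → ℝ) → ℝ)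
      (Φ : (Fin (n + 1) → ℝ) → (Fin n → ℝ)) (r₀ r₀' : Literature.NumberTheory.Transcendental.KZ.IntegralRep n)
      (K : ℕ) (C δ : ℝ) (D : Set (Fin (n + 1) → ℝ)) (ψ ψ' : (Fin (n + 1) → ℝ) → (Fin n → ℝ))
      (Dψ Dψ' : (Fin (n + 1) → ℝ) → (Fin n → ℝ) →L[ℝ] (Fin n → ℝ)),
      Literature.ModelTheory.ExponentialFields.IsSemialgebraic ℚ S →
      Literature.NumberTheory.Transcendental.IsSemialgebraicFunOn ℚ S G →
      Literature.ModelTheory.ExponentialFields.IsSemialgebraic ℚ S' →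
      Literature.NumberTheory.Transcendental.IsSemialgebraicFunOn ℚ S' G' →
      (∀ z ∈ S, (∀ i, |z i| ≤ N) ∧ |G z| ≤ N) → (∀ z ∈ S', (∀ i, |z i| ≤ N) ∧ |G' z| ≤ N) →
      ((0 < δ ∧ δ ≤ 1) ∧
        Literature.ModelTheory.ExponentialFields.IsSemialgebraic ℝ D ∧
        (∀ z ∈ D, (∃ k : ℕ, k < K ∧ ∀ i, 2 * (k : ℝ) < Fin.init z i ∧ Fin.init z i < 2 * (k : ℝ) + 1) ∧
          z (Fin.last n) ∈ Set.Ioo (0:ℝ) δ) ∧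
        (Literature.NumberTheory.Transcendental.IsSemialgebraicMapOn ℝ
            {z : Fin (n + 1) → ℝ | (∃ k : ℕ, k < K ∧ ∀ i, 2 * (k : ℝ) < Fin.init z i ∧
              Fin.init z i < 2 * (k : ℝ) + 1) ∧ z (Fin.last n) ∈ Set.Ioo (0:ℝ) δ} ψ ∧
          Literature.NumberTheory.Transcendental.IsSemialgebraicMapOn ℝ
            {z : Fin (n + 1) → ℝ | (∃ k : ℕ, k < K ∧ ∀ i, 2 * (k : ℝ) < Fin.init z i ∧
              Fin.init z i < 2 * (k : ℝ) + 1) ∧ z (Fin.last n) ∈ Set.Ioo (0:ℝ) δ} ψ') ∧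
        (∀ i j : Fin n,
          Literature.NumberTheory.Transcendental.IsSemialgebraicFunOn ℝ
            {z : Fin (n + 1) → ℝ | (∃ k : ℕ, k < K ∧ ∀ i, 2 * (k : ℝ) < Fin.init z i ∧
              Fin.init z i < 2 * (k : ℝ) + 1) ∧ z (Fin.last n) ∈ Set.Ioo (0:ℝ) δ}
            (fun z => (Dψ z) (Pi.single j (1:ℝ)) i) ∧
          Literature.NumberTheory.Transcendental.IsSemialgebraicFunOn ℝ
            {z : Fin (n + 1) → ℝ | (∃ k : ℕ, k < K ∧ ∀ i, 2 * (k : ℝ) < Fin.init z i ∧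
              Fin.init z i < 2 * (k : ℝ) + 1) ∧ z (Fin.last n) ∈ Set.Ioo (0:ℝ) δ}
            (fun z => (Dψ' z) (Pi.single j (1:ℝ)) i)) ∧
        (∀ t ∈ Set.Ioo (0:ℝ) δ, ∀ u : Fin n → ℝ,
          (∃ k : ℕ, k < K ∧ ∀ i, 2 * (k : ℝ) < u i ∧ u i < 2 * (k : ℝ) + 1) →
          HasFDerivAt (fun v : Fin n → ℝ => ψ (Fin.snoc v t)) (Dψ (Fin.snoc u t)) u ∧
          HasFDerivAt (fun v : Fin n → ℝ => ψ' (Fin.snoc v t)) (Dψ' (Fin.snoc u t)) u ∧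
          ‖Dψ (Fin.snoc u t)‖ ≤ C ∧ ‖Dψ' (Fin.snoc u t)‖ ≤ C ∧
          |(Dψ (Fin.snoc u t)).det| ≤ C ∧ |(Dψ' (Fin.snoc u t)).det| ≤ C ∧
          Fin.snoc (ψ (Fin.snoc u t)) t ∈ S ∧ Fin.snoc (ψ' (Fin.snoc u t)) t ∈ S' ∧
          ψ' (Fin.snoc u t) = Φ (Fin.snoc (ψ (Fin.snoc u t)) t)) ∧
        (∀ t ∈ Set.Ioo (0:ℝ) δ, ∀ k : ℕ, k < K → ∀ u v : Fin n → ℝ,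
          (∀ i, 2 * (k : ℝ) < u i ∧ u i < 2 * (k : ℝ) + 1) → (∀ i, 2 * (k : ℝ) < v i ∧ v i < 2 * (k : ℝ) + 1) →
          ‖Dψ (Fin.snoc u t) - Dψ (Fin.snoc v t)‖ ≤ C * ‖u - v‖ ∧
          ‖Dψ' (Fin.snoc u t) - Dψ' (Fin.snoc v t)‖ ≤ C * ‖u - v‖) ∧
        (∀ t ∈ Set.Ioo (0:ℝ) δ,
          Set.InjOn (fun u : Fin n → ℝ => ψ (Fin.snoc u t)) {u | Fin.snoc u t ∈ D} ∧
          Set.InjOn (fun u : Fin n → ℝ => ψ' (Fin.snoc u t)) {u | Fin.snoc u t ∈ D} ∧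
          MeasureTheory.volume ({x : Fin n → ℝ | Fin.snoc x t ∈ S} \
            (fun u : Fin n → ℝ => ψ (Fin.snoc u t)) '' {u | Fin.snoc u t ∈ D}) = 0 ∧
          MeasureTheory.volume ({y : Fin n → ℝ | Fin.snoc y t ∈ S'} \
            (fun u : Fin n → ℝ => ψ' (Fin.snoc u t)) '' {u | Fin.snoc u t ∈ D}) = 0) ∧
        (∀ t ∈ Set.Ioo (0:ℝ) δ, ∀ u : Fin n → ℝ, Fin.snoc u t ∈ D →
          G (Fin.snoc (ψ (Fin.snoc u t)) t) * |(Dψ (Fin.snoc u t)).det| =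
            G' (Fin.snoc (ψ' (Fin.snoc u t)) t) * |(Dψ' (Fin.snoc u t)).det|)) →
      Filter.Tendsto (fun t : ℝ => ∫ x : Fin n → ℝ,
          |{x : Fin n → ℝ | Fin.snoc x t ∈ S}.indicator (fun x => G (Fin.snoc x t)) x
            - r₀.domain.indicator r₀.integrand x|) (𝓝[>] (0:ℝ)) (𝓝 0) →
      Filter.Tendsto (fun t : ℝ => ∫ y : Fin n → ℝ,
          |{y : Fin n → ℝ | Fin.snoc y t ∈ S'}.indicator (fun y => G' (Fin.snoc y t)) y
            - r₀'.domain.indicator r₀'.integrand y|) (𝓝[>] (0:ℝ)) (𝓝 0) →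
      Literature.NumberTheory.Transcendental.KZ.Equivalent r₀ r₀'

/-- **Glue (proved):** the two pieces give the crux BY NAME. -/
theorem TameCovLimit_of_subs : CovFamilyChartFactorisation → BoundedLegsCovLimit → TameCovLimit := by
  intro h₁ h₂ n N S S' G G' Φ r₀ r₀' hS hG hS' hG' hΦ hb hb' hcov hL hL'
  obtain ⟨K, C, δ, D, ψ, ψ', Dψ, Dψ', hP⟩ := h₁ N S S' G G' Φ hS hG hS' hG' hΦ hb hb' hcov
  exact h₂ N S S' G G' Φ r₀ r₀' K C δ D ψ ψ' Dψ Dψ' hS hG hS' hG' hb hb' hP hL hL'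

end Summit.KontsevichZagierPeriods.KontsevichZagierPeriods.Cruxes.TameCovLimit.Split

end
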